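import Literature.AlgebraicGeometry.Resolution.VertexProjectionRingHomSmooth
import Literature.AlgebraicGeometry.Motives.ProjectiveSpaceFunctionField
import Mathlib.FieldTheory.Minpoly.IsIntegrallyClosed
import Mathlib.AlgebraicGeometry.Morphisms.Finite

/-!
# `WeightedInvariant.WeightedThesis`, line `datum-glued-split`, stub 5 (hypersurface models), I:
# the image of a finite morphism to `ℙ^{d+1} ∖ {vertex}` has locally principal ideal

Route `ResolutionOfSingularities/WeightedInvariant`, crux `WeightedThesis`
(stmt-ResolutionOfSingularities-0569). First of four files proving `stub_hypersurfaceModel` over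
infinite perfect fields. PROVED here (`stub_imageIdealLocallyPrincipal`, registered shape): for
`X` integral and `φ : X → ℙ^{d+1} ∖ {vertex}` finite with `pr ∘ φ : X → ℙ^d` finite surjective,
every point of `ℙ^{d+1} ∖ {vertex}` has an affine chart `D₊(x_i) = Spec R[T]`
(`R = k[x_a/x_i : a ≤ d]`, `DeJong1996.basePolyEquiv`) on which the kernel of `φ^*` is principal —
generated by the minimal polynomial over the integrally closed `R` of `T = x_{d+1}/x_i`
(Mathlib `minpoly.ker_eval`), `R → Γ(φ⁻¹D₊(x_i), 𝒪_X)` being injective and integral (base change of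
`pr ∘ φ` to the chart). [Hartshorne I Prop. 4.9 (proof); Kollár 2007, proof of Prop. 2.48]
-/

noncomputable section

set_option linter.dupNamespace false -- mandated namespace of this single-conjunct summit

open CategoryTheory CategoryTheory.Limits AlgebraicGeometry TopologicalSpace HomogeneousLocalization
open Literature.AlgebraicGeometry.Resolution Literature.AlgebraicGeometry.Motives
open Literature.AlgebraicGeometry.Motives.Segre (grading cst frac chartι toSpec X_mem pull pull_comp
  pull_SpecMap')

attribute [local instance] MvPolynomial.gradedAlgebra

namespace Summit.ResolutionOfSingularities.ResolutionOfSingularities.Theorems.WeightedThesis.HypersurfaceModel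

universe u

/-! # Part B: the image ideal is locally principal -/

/-! ## Algebra: the kernel of `R[T] → A` is principal -/

/-- **The kernel of `R[T] → A` is generated by a minimal polynomial.** For an integrally closed
domain `R`, a domain `A` and a ring map `χ : R[T] → A` which is injective and integral on `R`,
`ker χ = (μ)` for the minimal polynomial `μ` over `R` of `θ = χ(T)` (Mathlib `minpoly.ker_eval`:
over an integrally closed domain the minimal polynomial divides every polynomial vanishing at
`θ`). [folklore] -/
theorem ker_isPrincipal_of_isIntegral {R A : Type*} [CommRing R] [IsDomain R] [IsIntegrallyClosed R]
    [CommRing A] [IsDomain A] (χ : Polynomial R →+* A) (hint : (χ.comp Polynomial.C).IsIntegral)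
    (hinj : Function.Injective (χ.comp Polynomial.C)) : (RingHom.ker χ).IsPrincipal := by
  letI : Algebra R A := (χ.comp Polynomial.C).toAlgebra
  haveI : Module.IsTorsionFree R A := Module.isTorsionFree_iff_algebraMap_injective.mpr hinj
  have hθ : IsIntegral R (χ Polynomial.X) := hint _
  have hχ : χ = (Polynomial.aeval (χ Polynomial.X)).toRingHom := by
    refine Polynomial.ringHom_ext (fun r => ?_) ?_
    · change _ = Polynomial.aeval (χ Polynomial.X) (Polynomial.C r)
      rw [Polynomial.aeval_C]; rfl
    · change _ = Polynomial.aeval (χ Polynomial.X) Polynomial.X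
      rw [Polynomial.aeval_X]
  rw [hχ, minpoly.ker_eval hθ]
  exact ⟨⟨minpoly R (χ Polynomial.X), rfl⟩⟩

/-- Principality of the kernel is insensitive to an isomorphism of the source. [folklore] -/
theorem ker_comp_equiv_isPrincipal_iff {B B' A : Type*} [CommRing B] [CommRing B'] [CommRing A]
    (e : B ≃+* B') (χ : B' →+* A) :
    (RingHom.ker (χ.comp e.toRingHom)).IsPrincipal ↔ (RingHom.ker χ).IsPrincipal := by
  have hmem : ∀ x : B', x ∈ RingHom.ker χ ↔ e.symm x ∈ RingHom.ker (χ.comp e.toRingHom) := fun x => by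
    simp only [RingHom.mem_ker, RingHom.coe_comp, Function.comp_apply, RingEquiv.toRingHom_eq_coe,
      RingEquiv.coe_toRingHom, RingEquiv.apply_symm_apply]
  constructor
  · rintro ⟨⟨b, hb⟩⟩
    refine ⟨⟨e b, Ideal.ext fun x => ?_⟩⟩
    change _ ↔ x ∈ Ideal.span {e b}
    rw [hmem, hb, Ideal.mem_span_singleton]
    change b ∣ e.symm x ↔ _
    rw [Ideal.mem_span_singleton]
    constructor
    · intro h
      simpa using map_dvd e h
    · intro h
      simpa using map_dvd e.symm h
  · rintro ⟨⟨b', hb'⟩⟩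
    refine ⟨⟨e.symm b', Ideal.ext fun y => ?_⟩⟩
    change _ ↔ y ∈ Ideal.span {e.symm b'}
    have : y ∈ RingHom.ker (χ.comp e.toRingHom) ↔ e y ∈ RingHom.ker χ := by
      rw [hmem, RingEquiv.symm_apply_apply]
    rw [this, hb', Ideal.mem_span_singleton]
    change b' ∣ e y ↔ _
    rw [Ideal.mem_span_singleton]
    constructor
    · intro h
      simpa using map_dvd e.symm h
    · intro h
      simpa using map_dvd e h

/-- Principality of the kernel is insensitive to an injective map after. [folklore] -/
theorem ker_comp_isPrincipal_iff_of_injective {B A A' : Type*} [CommRing B] [CommRing A] [CommRing A']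
    (χ : B →+* A) {g : A →+* A'} (hg : Function.Injective g) :
    (RingHom.ker (g.comp χ)).IsPrincipal ↔ (RingHom.ker χ).IsPrincipal := by
  rw [RingHom.ker_comp_of_injective χ hg]

/-! ## Kernels on an affine chart `Spec B ≅ U ⊆ Y` -/

/-- For an open immersion `c : Spec B → Y` with image `U` and any `φ : X → Y`, the kernel of
`φ^* : Γ(Y, U) → Γ(X, φ⁻¹U)` is principal iff the kernel of the ring map
`B → Γ(φ⁻¹U, 𝒪)` of `φ⁻¹U → U ≅ Spec B` is (the two differ by isomorphisms on both sides).
[folklore] -/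
theorem ker_app_isPrincipal_iff_pull {X Y : Scheme.{u}} (φ : X ⟶ Y) {B : CommRingCat.{u}}
    (c : Spec B ⟶ Y) [IsOpenImmersion c] :
    (RingHom.ker (φ.app c.opensRange).hom).IsPrincipal ↔
      (RingHom.ker (pull ((φ ∣_ c.opensRange) ≫ c.isoOpensRange.inv))).IsPrincipal := by
  set U := c.opensRange
  let i₁ : B ≅ Γ(U, ⊤) := (Scheme.ΓSpecIso B).symm ≪≫ (Scheme.Γ.mapIso c.isoOpensRange.op).symm
  let g := X.presheaf.map (eqToHom (image_morphismRestrict_preimage φ U ⊤)).op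
  haveI : IsIso g := by infer_instance
  have hg : Function.Injective g.hom := (ConcreteCategory.bijective_of_isIso g).1
  have h1 : pull ((φ ∣_ U) ≫ c.isoOpensRange.inv) =
      g.hom.comp ((φ.app (U.ι ''ᵁ ⊤)).hom.comp i₁.commRingCatIsoToRingEquiv.toRingHom) := by
    change ((Scheme.ΓSpecIso B).inv ≫ ((φ ∣_ U) ≫ c.isoOpensRange.inv).appTop).hom = _
    rw [Scheme.Hom.comp_appTop, morphismRestrict_appTop]
    rfl
  rw [h1]
  refine ((ker_comp_isPrincipal_iff_of_injective _ hg).trans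
    ((ker_comp_equiv_isPrincipal_iff _ _).trans (iff_of_eq ?_))).symm
  exact congrArg (fun V : Y.Opens => (RingHom.ker (φ.app V).hom).IsPrincipal)
    (Scheme.Opens.ι_image_top U)

/-- **Base change of a finite surjective morphism to an affine chart.** If `β : W → Spec R'` is the
base change of the finite surjective `ψ : X → P` (`P` integral) along an open immersion
`Spec R' → P`, then the ring map `R' → Γ(W, 𝒪)` of `β` is integral and injective (`β` is finite
and dominant onto the reduced `Spec R'`, hence scheme-theoretically dominant). [folklore] -/
theorem isIntegral_and_injective_pull {W X P : Scheme.{u}} {R' : CommRingCat.{u}}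
    (β : W ⟶ Spec R') (ι' : W ⟶ X) (cP : Spec R' ⟶ P) (ψ : X ⟶ P)
    [IsOpenImmersion ι'] [IsOpenImmersion cP] [IsFinite ψ] [Surjective ψ] [IsIntegral P]
    (hpb : IsPullback β ι' cP ψ) :
    (pull β).IsIntegral ∧ Function.Injective (pull β) := by
  haveI : IsFinite β := MorphismProperty.of_isPullback hpb.flip inferInstance
  haveI : Surjective β := MorphismProperty.of_isPullback hpb.flip inferInstance
  haveI : IsReduced (Spec R') := isReduced_of_isOpenImmersion cP
  haveI : IsSchemeTheoreticallyDominant β := .of_isDominant β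
  have hinj : Function.Injective β.appTop := β.app_injective ⊤
  have hint : β.appTop.hom.IsIntegral := β.isIntegral_app ⊤ (isAffineOpen_top (Spec R'))
  have hbij := ConcreteCategory.bijective_of_isIso (Scheme.ΓSpecIso R').inv
  change (β.appTop.hom.comp (Scheme.ΓSpecIso R').inv.hom).IsIntegral ∧
    Function.Injective (β.appTop.hom.comp (Scheme.ΓSpecIso R').inv.hom)
  exact ⟨RingHom.IsIntegral.trans _ _ (RingHom.isIntegral_of_surjective _ hbij.2) hint,
    hinj.comp hbij.1⟩

/-! ## The charts `D₊(x_i)` of the punctured space -/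

section Punctured

variable (d : ℕ) (k : Type u) [Field k]

/-- The chart `D₊(x_i) → ℙ^{d+1} ∖ {vertex}`, `i ≤ d`, is an open immersion (its composite with
the inclusion into `ℙ^{d+1}` is the standard chart). [folklore] -/
theorem isOpenImmersion_chartToPunctured (i : Fin (d + 1)) :
    IsOpenImmersion (DeJong1996.chartToPunctured d k i) := by
  haveI : IsOpenImmersion (DeJong1996.chartToPunctured d k i ≫ (DeJong1996.puncturedSpace d k).ι) := by
    rw [DeJong1996.chartToPunctured_ι]
    infer_instance
  exact IsOpenImmersion.of_comp _ (DeJong1996.puncturedSpace d k).ι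

attribute [local instance] isOpenImmersion_chartToPunctured

/-- The image of the chart `D₊(x_i) → ℙ^{d+1} ∖ {vertex}` is the trace of `D₊(x_i)`. [folklore] -/
theorem opensRange_chartToPunctured (i : Fin (d + 1)) :
    (DeJong1996.chartToPunctured d k i).opensRange =
      (DeJong1996.puncturedSpace d k).ι ⁻¹ᵁ
        Proj.basicOpen (grading (Fin (d + 1 + 1)) k) (MvPolynomial.X (Fin.castSucc i)) := by
  refine Opens.ext (Set.ext fun y => ?_)
  have hrange : Set.range (chartι k (Fin.castSucc i) : _ ⟶ Proj (grading (Fin (d + 1 + 1)) k)) =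
      (Proj.basicOpen (grading (Fin (d + 1 + 1)) k) (MvPolynomial.X (Fin.castSucc i)) : Set _) := by
    rw [← Scheme.Hom.coe_opensRange, Proj.opensRange_awayι]
  constructor
  · rintro ⟨t, rfl⟩
    show (DeJong1996.chartToPunctured d k i ≫ (DeJong1996.puncturedSpace d k).ι) t ∈
      (Proj.basicOpen (grading (Fin (d + 1 + 1)) k) (MvPolynomial.X (Fin.castSucc i)) : Set _)
    rw [← hrange, DeJong1996.chartToPunctured_ι]
    exact ⟨t, rfl⟩
  · intro hy
    have hy' : (DeJong1996.puncturedSpace d k).ι y ∈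
        Set.range (chartι k (Fin.castSucc i) : _ ⟶ Proj (grading (Fin (d + 1 + 1)) k)) := by
      rw [hrange]; exact hy
    obtain ⟨t, ht⟩ := hy'
    refine ⟨t, (DeJong1996.puncturedSpace d k).ι.isOpenEmbedding.injective ?_⟩
    rw [← ht, ← Scheme.Hom.comp_apply, DeJong1996.chartToPunctured_ι]

/-- Every point of the punctured space lies in one of the charts `D₊(x_i)`, `i ≤ d`. [folklore] -/
theorem exists_mem_opensRange_chartToPunctured (y : DeJong1996.puncturedSpace d k) :
    ∃ i : Fin (d + 1), (y : ↥(DeJong1996.puncturedSpace d k)) ∈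
      (DeJong1996.chartToPunctured d k i).opensRange := by
  obtain ⟨i, hi⟩ := Opens.mem_iSup.1 y.2
  exact ⟨i, by rw [opensRange_chartToPunctured]; exact hi⟩

end Punctured

/-! ## Local principality of the image ideal -/

section Principal

variable (d : ℕ) (k : Type u) [Field k]

/-- **Algebra of the chart `D₊(x_i) = Spec R[T]`.** For a ring map `p : (k[x]_{(x_i)})₀ → A` to a
domain whose restriction along the projection from the vertex
`(k[y]_{(y_i)})₀ → (k[x]_{(x_i)})₀` is integral and injective, `ker p` is principal:
`(k[x]_{(x_i)})₀ ≅ R[T]` over `R = k[Y_a : a ≠ i] ≅ (k[y]_{(y_i)})₀`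
(`DeJong1996.basePolyEquiv`, `vertexProjectionRingHom_eq`), and the kernel of `R[T] → A` is
generated by a minimal polynomial (`ker_isPrincipal_of_isIntegral`). [folklore] -/
theorem ker_isPrincipal_of_comp_vertexProjectionRingHom (i : Fin (d + 1)) {A : Type u} [CommRing A]
    [IsDomain A] (p : Away (grading (Fin (d + 1 + 1)) k) (MvPolynomial.X (Fin.castSucc i)) →+* A)
    (hint : (p.comp (DeJong1996.vertexProjectionRingHom d k i)).IsIntegral)
    (hinj : Function.Injective (p.comp (DeJong1996.vertexProjectionRingHom d k i))) :
    (RingHom.ker p).IsPrincipal := by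
  let eB : Away (grading (Fin (d + 1 + 1)) k) (MvPolynomial.X (Fin.castSucc i)) ≃+*
      Polynomial (PointBlowup.Base d k i) :=
    (PointBlowup.awayBaseEquiv (d + 1) k (Fin.castSucc i)).trans (DeJong1996.basePolyEquiv d k i)
  let χ : Polynomial (PointBlowup.Base d k i) →+* A := p.comp eB.symm.toRingHom
  have hpχ : p = χ.comp eB.toRingHom := by
    refine RingHom.ext fun b => ?_
    simp [χ]
  have e1 : ∀ r, eB.symm (Polynomial.C r) =
      DeJong1996.vertexProjectionRingHom d k i ((PointBlowup.awayBaseEquiv d k i).symm r) := fun r => by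
    rw [DeJong1996.vertexProjectionRingHom_eq, DeJong1996.baseIncl_eq]
    simp [eB]
  have hχC : χ.comp Polynomial.C = (p.comp (DeJong1996.vertexProjectionRingHom d k i)).comp
      (PointBlowup.awayBaseEquiv d k i).symm.toRingHom := by
    refine RingHom.ext fun r => ?_
    change p (eB.symm (Polynomial.C r)) = p (DeJong1996.vertexProjectionRingHom d k i
      ((PointBlowup.awayBaseEquiv d k i).symm r))
    rw [e1]
  have hint' : (χ.comp Polynomial.C).IsIntegral := by
    rw [hχC]
    exact RingHom.IsIntegral.trans _ _
      (RingHom.isIntegral_of_surjective _ (PointBlowup.awayBaseEquiv d k i).symm.surjective) hint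
  have hinj' : Function.Injective (χ.comp Polynomial.C) := by
    rw [hχC]
    exact hinj.comp (PointBlowup.awayBaseEquiv d k i).symm.injective
  rw [hpχ, ker_comp_equiv_isPrincipal_iff]
  exact ker_isPrincipal_of_isIntegral χ hint' hinj'

attribute [local instance] isOpenImmersion_chartToPunctured

/-- **The chart square.** For `φ : X → ℙ^{d+1} ∖ {vertex}` and `i ≤ d`, the morphism
`φ⁻¹(D₊(x_i)) → D₊(x_i) = Spec (k[x]_{(x_i)})₀ → Spec (k[y]_{(y_i)})₀` (restriction of `φ`, then
the projection from the vertex on the chart) is the base change of `pr ∘ φ : X → ℙ^d` along the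
chart `D₊(y_i) ↪ ℙ^d` (`DeJong1996.chartToPunctured_comp_vertexProjection`). [folklore] -/
theorem isPullback_chart {X : Scheme.{u}} (φ : X ⟶ (DeJong1996.puncturedSpace d k : Scheme.{u}))
    (i : Fin (d + 1)) :
    IsPullback
      (((φ ∣_ (DeJong1996.chartToPunctured d k i).opensRange) ≫
          (DeJong1996.chartToPunctured d k i).isoOpensRange.inv) ≫
        Spec.map (CommRingCat.ofHom (DeJong1996.vertexProjectionRingHom d k i)))
      (φ ⁻¹ᵁ (DeJong1996.chartToPunctured d k i).opensRange).ι (chartι k i)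
      (φ ≫ DeJong1996.vertexProjection d k) := by
  refine IsOpenImmersion.isPullback _ _ _ _ ?_ ?_
  · have h2 : Spec.map (CommRingCat.ofHom (DeJong1996.vertexProjectionRingHom d k i)) ≫ chartι k i =
        DeJong1996.chartToPunctured d k i ≫ DeJong1996.vertexProjection d k := by
      rw [DeJong1996.chartToPunctured_comp_vertexProjection]; rfl
    simp only [Category.assoc]
    rw [h2, (DeJong1996.chartToPunctured d k i).isoOpensRange_inv_comp_assoc, ← morphismRestrict_ι_assoc]
  · rw [Scheme.Opens.opensRange_ι, Scheme.Hom.comp_preimage, Proj.opensRange_awayι,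
      DeJong1996.vertexProjection_preimage_basicOpen, opensRange_chartToPunctured]

/-- **The ideal of the image of `X` in `ℙ^{d+1} ∖ {vertex}` is locally principal.** Let `X` be
integral and `φ : X → ℙ^{d+1} ∖ {vertex}` finite with `ψ = pr ∘ φ : X → ℙ^d` finite and
surjective (`pr` the projection from the vertex). Then every point of `ℙ^{d+1} ∖ {vertex}` has
an affine neighbourhood — a chart `D₊(x_i)`, `i ≤ d` — on which the kernel of `φ^*` is a principal
ideal: on `D₊(x_i) = Spec R[T]`, `R = k[x_a/x_i : a ≤ d]`, `T = x_{d+1}/x_i`, the map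
`R → Γ(φ⁻¹D₊(x_i), 𝒪_X)` is `ψ^*` over `D₊(y_i)` (`isPullback_chart`), injective and integral
(`isIntegral_and_injective_pull`), into a domain, so the kernel of `R[T] → Γ(φ⁻¹D₊(x_i), 𝒪_X)`
is generated by a minimal polynomial (`ker_isPrincipal_of_comp_vertexProjectionRingHom`).
[cite: Hartshorne1977, I Prop. 4.9 (proof); folklore] -/
theorem exists_ker_ideal_isPrincipal {X : Scheme.{u}} [IsIntegral X]
    (φ : X ⟶ (DeJong1996.puncturedSpace d k : Scheme.{u})) [IsFinite φ]
    [IsFinite (φ ≫ DeJong1996.vertexProjection d k)]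
    [Surjective (φ ≫ DeJong1996.vertexProjection d k)]
    (y : ↥(DeJong1996.puncturedSpace d k)) :
    ∃ U : (DeJong1996.puncturedSpace d k : Scheme.{u}).affineOpens,
      (y ∈ (U : (DeJong1996.puncturedSpace d k : Scheme.{u}).Opens)) ∧
        (φ.ker.ideal U).IsPrincipal := by
  obtain ⟨i, hyi⟩ := exists_mem_opensRange_chartToPunctured d k y
  refine ⟨⟨(DeJong1996.chartToPunctured d k i).opensRange,
    isAffineOpen_opensRange (DeJong1996.chartToPunctured d k i)⟩, hyi, ?_⟩
  rw [Scheme.Hom.ker_apply]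
  change (RingHom.ker (φ.app (DeJong1996.chartToPunctured d k i).opensRange).hom).IsPrincipal
  rw [ker_app_isPrincipal_iff_pull φ (DeJong1996.chartToPunctured d k i)]
  have hpb := isPullback_chart d k φ i
  obtain ⟨hβint, hβinj⟩ := isIntegral_and_injective_pull _ _ _ _ hpb
  rw [pull_SpecMap', CommRingCat.hom_ofHom] at hβint hβinj
  -- the source `φ⁻¹ D₊(x_i) = ψ⁻¹ D₊(y_i)` is a non-empty open of the integral `X`
  haveI : Nonempty ↥(φ ⁻¹ᵁ (DeJong1996.chartToPunctured d k i).opensRange) := by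
    have hy' : DeJong1996.vertexProjection d k y ∈ (chartι k i).opensRange := by
      have : y ∈ DeJong1996.vertexProjection d k ⁻¹ᵁ
          Proj.basicOpen (grading (Fin (d + 1)) k) (MvPolynomial.X i) := by
        rw [DeJong1996.vertexProjection_preimage_basicOpen, ← opensRange_chartToPunctured]
        exact hyi
      rw [Proj.opensRange_awayι]
      exact this
    obtain ⟨x, hx⟩ := (φ ≫ DeJong1996.vertexProjection d k).surjective (DeJong1996.vertexProjection d k y)
    have hx' : x ∈ (φ ≫ DeJong1996.vertexProjection d k) ⁻¹ᵁ (chartι k i).opensRange := by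
      show (φ ≫ DeJong1996.vertexProjection d k) x ∈ (chartι k i).opensRange
      rw [hx]
      exact hy'
    rw [Scheme.Hom.comp_preimage, Proj.opensRange_awayι,
      DeJong1996.vertexProjection_preimage_basicOpen, ← opensRange_chartToPunctured] at hx'
    exact ⟨⟨x, hx'⟩⟩
  haveI : Nonempty ((φ ⁻¹ᵁ (DeJong1996.chartToPunctured d k i).opensRange : X.Opens) : Scheme.{u}) :=
    inferInstanceAs (Nonempty ↥(φ ⁻¹ᵁ (DeJong1996.chartToPunctured d k i).opensRange))
  haveI : IsIntegral (φ ⁻¹ᵁ (DeJong1996.chartToPunctured d k i).opensRange : Scheme.{u}) :=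
    isIntegral_of_isOpenImmersion (φ ⁻¹ᵁ (DeJong1996.chartToPunctured d k i).opensRange).ι
  exact ker_isPrincipal_of_comp_vertexProjectionRingHom d k i _ hβint hβinj

end Principal

/-- **S5b-image (PROVED), registered shape (universe `0`)**: the image of a finite
`φ : X → ℙ^{d+1} ∖ {vertex}` with `pr ∘ φ` finite surjective, `X` integral, has locally principal
ideal (`exists_ker_ideal_isPrincipal`). [cite: Hartshorne1977, I Prop. 4.9 (proof)] -/
theorem stub_imageIdealLocallyPrincipal : ∀ (d : ℕ) (k : Type) [Field k] (X : AlgebraicGeometry.Scheme.{0}) [AlgebraicGeometry.IsIntegral X] (φ : X ⟶ (Literature.AlgebraicGeometry.Resolution.DeJong1996.puncturedSpace d k : AlgebraicGeometry.Scheme.{0})) [AlgebraicGeometry.IsFinite φ] [AlgebraicGeometry.IsFinite (φ ≫ Literature.AlgebraicGeometry.Resolution.DeJong1996.vertexProjection d k)] [AlgebraicGeometry.Surjective (φ ≫ Literature.AlgebraicGeometry.Resolution.DeJong1996.vertexProjection d k)] (y : ↥(Literature.AlgebraicGeometry.Resolution.DeJong1996.puncturedSpace d k)), ∃ U : (Literature.AlgebraicGeometry.Resolution.DeJong1996.puncturedSpace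 d k : AlgebraicGeometry.Scheme.{0}).affineOpens, y ∈ (U : (Literature.AlgebraicGeometry.Resolution.DeJong1996.puncturedSpace d k : AlgebraicGeometry.Scheme.{0}).Opens) ∧ (φ.ker.ideal U).IsPrincipal :=
  fun d k _ _ _ φ _ _ _ y => exists_ker_ideal_isPrincipal d k φ y


end Summit.ResolutionOfSingularities.ResolutionOfSingularities.Theorems.WeightedThesis.HypersurfaceModel

end
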